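import Summits.Ventures.CertifiedQuantumChemistry.Rows.SingletVersusSector
import Summits.Ventures.CertifiedQuantumChemistry.Rows.NSector
import HarnessLib

/-!
# Ventures/CertifiedQuantumChemistry — Rows/SpinOneGroundState.lean: a certified SPIN-ONE ground state
# from three certified legs (an `S_z = 1` sector `U`, a singlet `L`, an `S_z = 2` sector `L`)

HONEST FRAMING (verbatim): certified bounds for a stated model Hamiltonian in a stated basis; not a
claim about the real molecule beyond that model.

var-1 (gen 8), zero compute, nothing landed is touched; PROVED glue only (0 sorry, no definition, no
claim node, nothing here asserts a bound). `Rows/SingletVersusSector.lean` (typer) gives the certified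
NON-singlet reading `SingletLowerRow.energy_eq_energy_of_gap`: a singlet LOWER row `lo₁` and an
`(n+1, n−1)` sector UPPER row `hi` with `hi < lo₁` prove `E(n, n) = E(n+1, n−1) < E₀(2n, S = 0)` — the
`2n`-electron ground multiplet of the model has spin `S ≥ 1`. This file adds the UPPER side of the spin
and the vector statements, i.e. the certified reading **"the ground state of the model is a TRIPLET"**:

* `spinPlus_mulVec_eq_zero_or_sectorGroundEnergy_le_of_sector` — the one-step `Ŝ_+` ladder from ANY
  sector `(a, b+1)` (the tree lemma is the balanced case `(n, n)`): an eigenvector `χ` of a Hermitian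
  `H` commuting with `Ŝ_+`, eigenvalue `E`, has `Ŝ_+ χ = 0` or `E(a+1, b) ≤ E`
  (`RaisesSpin.isInSector_mulVec`, Tasaki §9.3; Lieb–Mattis 1962 §I).
* `spinPlus_pow_mulVec_eq_zero_of_lt` — **the `(Ŝ_+)^m` highest-weight lemma**: an eigenvector of the
  sector `(a, b)` with eigenvalue `E < E(a+m, b−m)` (`1 ≤ m ≤ b`) satisfies `Ŝ_+^m χ = 0` (no component
  of total spin `S ≥ S_z + m`); row reading `spinPlus_pow_mulVec_eq_zero_of_gap`: an `(n, n)` `U = hi`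
  and an `(n+m, n−m)` sector `L = lo` with `hi < lo` certify that the model's `2n`-electron ground
  states in `S_z = 0` have `S < m` (`m = 1` singlet — cf. `Rows/SingletFromSectorGap.lean`; `m = 2`
  spin `≤ 1`; general `m`: the lemma pub-qchem INBOX L297 (2) asks for before any `m ≥ 2` row).
* ROW READING `UpperRow.spinOne_of_gaps` — with THREE certified legs on one symmetric model,
  `hU : UpperRow F (n+1) (n−1) hi` (an exact-vector `U` in the `S_z = 1` sector),
  `hS : SingletLowerRow F n lo₁` (a singlet-restricted SDP `L`), `hQ : LowerRow F (n+2) (n−2) lo₂`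
  (a sector SDP `L` in the `S_z = 2` sector), and the two rational gaps `hi < lo₁`, `hi < lo₂`
  (`2 ≤ n`):  `E(n, n) = E(n+1, n−1)`, `E(n, n) < E₀(2n, S = 0)` and `E(n, n) < E(n+2, n−2)`;
  hence (`groundVector_spinOne_of_gaps`) every ground vector `χ ≠ 0` of the `(n, n)` sector has
  `Ŝ_+ χ ≠ 0` and `Ŝ_+ (Ŝ_+ χ) = 0`, and (`groundVector_szOne_highestWeight_of_gaps`) every ground
  vector of the `(n+1, n−1)` sector is annihilated by `Ŝ_+` — a highest-weight vector of weight `1`,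
  i.e. total spin exactly `1`; and (`Bracket.groundEnergy_mem_of_singletGap`) an `(n+1, n−1)` bracket
  brackets `E₀(H_F; 2n)`.
First intended instance (not asserted here): bench registry F32 = H₈ ring STO-3G R = 1/√2 Å
(`Hamiltonians/H8RingSto3gR0707.lean`, `n = 4`), whose `(4,4)` ground state is a triplet
(HOME/pub-qchem-var/spin/SPIN-F32.md: var-1 `U(5,3)` certificate + the two SDP legs it names).
-/

noncomputable section

namespace Summit.Ventures.CertifiedQuantumChemistry

open Matrix Finset
open Literature.MathematicalPhysics.QuantumLattice Literature.MathematicalPhysics.QuantumChemistry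
open scoped ComplexOrder

/-! ## Generic: `Ŝ_+` ladder steps from an arbitrary sector -/

section Generic

variable {Λ : Type*} [LinearOrder Λ] [Fintype Λ]

/-- **One `Ŝ_+` step from the sector `(a, b + 1)`.** For a Hermitian `H` commuting with `Ŝ_+` and an
eigenvector `χ` of `H` in the sector `(a, b + 1)` with eigenvalue `E`: either `Ŝ_+ χ = 0`, or `Ŝ_+ χ` is
a nonzero eigenvector with eigenvalue `E` in the sector `(a + 1, b)`, so `E(a + 1, b) ≤ E`. -/
theorem spinPlus_mulVec_eq_zero_or_sectorGroundEnergy_le_of_sector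
    {H : Matrix (Finset (Orb Λ)) (Finset (Orb Λ)) ℂ} (hH : H.IsHermitian) (hcommP : Commute H spinPlus)
    {a b : ℕ} {χ : Fock (Orb Λ)} (hχ : IsInSector a (b + 1) χ) {E : ℝ}
    (hHχ : H *ᵥ χ = ((E : ℝ) : ℂ) • χ) :
    spinPlus *ᵥ χ = 0 ∨ sectorGroundEnergy H (a + 1) b ≤ E := by
  by_cases h0 : spinPlus *ᵥ χ = 0
  · exact Or.inl h0
  · refine Or.inr ?_
    have hφs : IsInSector (a + 1) b (spinPlus *ᵥ χ) :=
      LiebThm1.raisesSpin_spinPlus.isInSector_mulVec hχ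
    have hHφ : H *ᵥ (spinPlus *ᵥ χ) = ((E : ℝ) : ℂ) • (spinPlus *ᵥ χ) := by
      rw [mulVec_mulVec, hcommP.eq, ← mulVec_mulVec, hHχ, mulVec_smul]
    exact sectorGroundEnergy_le_of_rayleigh hH hφs h0
      (by rw [hHφ, dotProduct_smul, smul_eq_mul, Complex.re_ofReal_mul])

/-- **An eigenvector below the next `S_z` sector is `Ŝ_+`-annihilated**: in the sector `(a, b + 1)`,
an eigenvector with eigenvalue `E < E(a + 1, b)` satisfies `Ŝ_+ χ = 0`. -/
theorem spinPlus_mulVec_eq_zero_of_lt_of_sector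
    {H : Matrix (Finset (Orb Λ)) (Finset (Orb Λ)) ℂ} (hH : H.IsHermitian) (hcommP : Commute H spinPlus)
    {a b : ℕ} {χ : Fock (Orb Λ)} (hχ : IsInSector a (b + 1) χ) {E : ℝ}
    (hHχ : H *ᵥ χ = ((E : ℝ) : ℂ) • χ) (hlt : E < sectorGroundEnergy H (a + 1) b) :
    spinPlus *ᵥ χ = 0 :=
  (spinPlus_mulVec_eq_zero_or_sectorGroundEnergy_le_of_sector hH hcommP hχ hHχ).resolve_right
    (not_le.2 hlt)

/-- **`Ŝ_+^j` maps the sector `(a, b)` into `(a + j, b − j)`** (`j ≤ b`; iterate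
`RaisesSpin.isInSector_mulVec`). -/
theorem isInSector_spinPlus_pow_mulVec {a b : ℕ} {χ : Fock (Orb Λ)} (hχ : IsInSector a b χ) {j : ℕ}
    (hj : j ≤ b) :
    IsInSector (a + j) (b - j) ((spinPlus ^ j : Matrix (Finset (Orb Λ)) (Finset (Orb Λ)) ℂ) *ᵥ χ) := by
  induction j with
  | zero => simpa using hχ
  | succ j ih =>
    have h1 := ih (by omega)
    rw [show b - j = b - (j + 1) + 1 by omega] at h1
    have h2 := LiebThm1.raisesSpin_spinPlus.isInSector_mulVec h1
    rw [mulVec_mulVec, ← pow_succ'] at h2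
    exact h2

/-- `Ŝ_+^j χ` is again an eigenvector with the same eigenvalue (or zero) when `[H, Ŝ_+] = 0`. -/
theorem mulVec_spinPlus_pow_mulVec_of_eigen {H : Matrix (Finset (Orb Λ)) (Finset (Orb Λ)) ℂ}
    (hcommP : Commute H spinPlus) {χ : Fock (Orb Λ)} {E : ℝ} (hHχ : H *ᵥ χ = ((E : ℝ) : ℂ) • χ)
    (j : ℕ) :
    H *ᵥ ((spinPlus ^ j : Matrix (Finset (Orb Λ)) (Finset (Orb Λ)) ℂ) *ᵥ χ) =
      ((E : ℝ) : ℂ) • ((spinPlus ^ j : Matrix (Finset (Orb Λ)) (Finset (Orb Λ)) ℂ) *ᵥ χ) := by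
  rw [mulVec_mulVec, (hcommP.pow_right j).eq, ← mulVec_mulVec, hHχ, mulVec_smul]

/-- **`m` steps of the `Ŝ_+` ladder (the `(Ŝ_+)^m` highest-weight lemma).** For a Hermitian `H`
commuting with `Ŝ_+`, an eigenvector `χ` of the sector `(a, b)` whose eigenvalue `E` lies strictly
below the sector energy `E(a + m, b − m)` (`1 ≤ m ≤ b`) satisfies `Ŝ_+^m χ = 0`: `χ` has no component
of total spin `S ≥ S_z + m` (`S_z = (a − b)/2`). Proof: `Ŝ_+^(m−1) χ` is an eigenvector with
eigenvalue `E` in the sector `(a + m − 1, b − m + 1)` (or zero); one more step would produce a trial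
state of energy `E` in `(a + m, b − m)`. (Lieb–Mattis 1962 §I; Tasaki 2020 §9.3.) -/
theorem spinPlus_pow_mulVec_eq_zero_of_lt
    {H : Matrix (Finset (Orb Λ)) (Finset (Orb Λ)) ℂ} (hH : H.IsHermitian) (hcommP : Commute H spinPlus)
    {a b m : ℕ} (hm : 1 ≤ m) (hmb : m ≤ b) {χ : Fock (Orb Λ)} (hχ : IsInSector a b χ) {E : ℝ}
    (hHχ : H *ᵥ χ = ((E : ℝ) : ℂ) • χ) (hlt : E < sectorGroundEnergy H (a + m) (b - m)) :
    (spinPlus ^ m : Matrix (Finset (Orb Λ)) (Finset (Orb Λ)) ℂ) *ᵥ χ = 0 := by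
  obtain ⟨j, rfl⟩ : ∃ j, m = j + 1 := ⟨m - 1, by omega⟩
  have hsec := isInSector_spinPlus_pow_mulVec hχ (show j ≤ b by omega)
  rw [show b - j = b - (j + 1) + 1 by omega] at hsec
  have heig := mulVec_spinPlus_pow_mulVec_of_eigen hcommP hHχ j
  have h := spinPlus_mulVec_eq_zero_of_lt_of_sector hH hcommP hsec heig hlt
  rw [mulVec_mulVec, ← pow_succ'] at h
  exact h

/-- The two-step instance used for spin one: an eigenvector of the balanced sector `(m + 2, m + 2)`
with eigenvalue `E < E(m + 4, m)` satisfies `Ŝ_+ (Ŝ_+ χ) = 0` (no component of spin `≥ 2`). -/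
theorem spinPlus_spinPlus_mulVec_eq_zero_of_lt
    {H : Matrix (Finset (Orb Λ)) (Finset (Orb Λ)) ℂ} (hH : H.IsHermitian) (hcommP : Commute H spinPlus)
    {m : ℕ} {χ : Fock (Orb Λ)} (hχ : IsInSector (m + 2) (m + 2) χ) {E : ℝ}
    (hHχ : H *ᵥ χ = ((E : ℝ) : ℂ) • χ) (hlt : E < sectorGroundEnergy H (m + 2 + 2) (m + 2 - 2)) :
    spinPlus *ᵥ (spinPlus *ᵥ χ) = 0 := by
  have h := spinPlus_pow_mulVec_eq_zero_of_lt hH hcommP (show 1 ≤ 2 by omega) (show 2 ≤ m + 2 by omega)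
    hχ hHχ hlt
  rwa [pow_two, ← mulVec_mulVec] at h

end Generic

/-! ## The model: three legs certify a spin-one ground state -/

variable {k : ℕ}

/-- **Certified spin-one ground state (energies).** On a symmetric model, an `(n+1, n−1)` sector UPPER
row `hi`, a singlet LOWER row `lo₁` and an `(n+2, n−2)` sector LOWER row `lo₂` with `hi < lo₁` and
`hi < lo₂` (`2 ≤ n`) prove: `E(n, n) = E(n+1, n−1)`, `E(n, n) < E₀(H_F; 2n, S = 0)` and
`E(n, n) < E(n+2, n−2)` — the `2n`-electron ground multiplet of the model is neither a singlet nor of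
spin `≥ 2`. -/
theorem UpperRow.spinOne_of_gaps {F : Model k} (hF : F.IsSymmetric) {n : ℕ} {hi lo₁ lo₂ : ℚ}
    (hU : UpperRow F (n + 1) (n - 1) hi) (hS : SingletLowerRow F n lo₁)
    (hQ : LowerRow F (n + 2) (n - 2) lo₂) (h₁ : hi < lo₁) (h₂ : hi < lo₂) (hn : 2 ≤ n) :
    F.energy n n = F.energy (n + 1) (n - 1) ∧ F.energy n n < F.singletEnergy n ∧
      F.energy n n < F.energy (n + 2) (n - 2) := by
  have h := SingletLowerRow.energy_eq_energy_of_gap hF hS hU h₁ (by omega)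
  refine ⟨h.1, h.2, ?_⟩
  calc F.energy n n = F.energy (n + 1) (n - 1) := h.1
    _ ≤ ((hi : ℚ) : ℝ) := hU.le
    _ < ((lo₂ : ℚ) : ℝ) := by exact_mod_cast h₂
    _ ≤ F.energy (n + 2) (n - 2) := hQ.le

/-- Under the three legs, `E(n+1, n−1) < E(n+2, n−2)`: the `S_z = 1` sector is strictly below the
`S_z = 2` sector. -/
theorem UpperRow.energy_succ_pred_lt_of_gaps {F : Model k} (hF : F.IsSymmetric) {n : ℕ}
    {hi lo₁ lo₂ : ℚ} (hU : UpperRow F (n + 1) (n - 1) hi) (hS : SingletLowerRow F n lo₁)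
    (hQ : LowerRow F (n + 2) (n - 2) lo₂) (h₁ : hi < lo₁) (h₂ : hi < lo₂) (hn : 2 ≤ n) :
    F.energy (n + 1) (n - 1) < F.energy (n + 2) (n - 2) := by
  have h := UpperRow.spinOne_of_gaps hF hU hS hQ h₁ h₂ hn
  rw [← h.1]; exact h.2.2

/-- An `(n+1, n−1)` sector UPPER row is also an `(n, n)` sector upper row (`E(n, n) ≤ E(n+1, n−1)`,
`Model.energy_le_energy_succ_pred`; `1 ≤ n`). -/
theorem UpperRow.balanced_of_succ_pred {F : Model k} (hF : F.IsSymmetric) {n : ℕ} {hi : ℚ}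
    (hU : UpperRow F (n + 1) (n - 1) hi) (hn : 1 ≤ n) : UpperRow F n n hi :=
  ⟨by have := hU.range.1; omega, by have := hU.range.1; omega,
    (Model.energy_le_energy_succ_pred hF hn hU.range.1).trans hU.le⟩

/-- **Certified `S < S_z,min + m` (row reading of the `(Ŝ_+)^m` lemma).** On a symmetric model, an
`(n, n)` sector UPPER row `hi` and an `(n + m, n − m)` sector LOWER row `lo` with `hi < lo`
(`1 ≤ m ≤ n`) prove that every eigenvector of `H_F` in the `(n, n)` sector at the sector energy is
annihilated by `Ŝ_+^m` — the `2n`-electron ground states of the model in `S_z = 0` have total spin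
`S < m`. (`m = 1`: singlet, cf. `Rows/SingletFromSectorGap.lean`; `m = 2`: spin `≤ 1`, this file.) -/
theorem spinPlus_pow_mulVec_eq_zero_of_gap {F : Model k} (hF : F.IsSymmetric) {n m : ℕ}
    {hi lo : ℚ} (hU : UpperRow F n n hi) (hL : LowerRow F (n + m) (n - m) lo) (hgap : hi < lo)
    (hm : 1 ≤ m) (hmn : m ≤ n) {χ : Fock (Orb (Fin k))} (hχ : IsInSector n n χ)
    (hHχ : F.hamiltonian *ᵥ χ = ((F.energy n n : ℝ) : ℂ) • χ) :
    (spinPlus ^ m : Matrix (Finset (Orb (Fin k))) (Finset (Orb (Fin k))) ℂ) *ᵥ χ = 0 := by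
  have hlt : F.energy n n < F.energy (n + m) (n - m) :=
    lt_of_le_of_lt hU.le (lt_of_lt_of_le (by exact_mod_cast hgap) hL.le)
  exact spinPlus_pow_mulVec_eq_zero_of_lt (F.hamiltonian_isHermitian hF)
    (molecularHamiltonian_commute_spinPlus _ _ _) hm hmn hχ hHχ hlt

/-- The energy form of the same reading: `E(n, n) < E(n + m, n − m)` from the two rows. -/
theorem UpperRow.energy_lt_energy_of_gap {F : Model k} {n m : ℕ} {hi lo : ℚ}
    (hU : UpperRow F n n hi) (hL : LowerRow F (n + m) (n - m) lo) (hgap : hi < lo) :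
    F.energy n n < F.energy (n + m) (n - m) :=
  lt_of_le_of_lt hU.le (lt_of_lt_of_le (by exact_mod_cast hgap) hL.le)

/-- **Ground vectors of the balanced sector have spin exactly one** (certified): under the three legs,
every nonzero eigenvector `χ` of `H_F` in the `(n, n)` sector at the sector energy satisfies
`Ŝ_+ χ ≠ 0` (it is not a singlet) and `Ŝ_+ (Ŝ_+ χ) = 0` (it has no component of spin `≥ 2`). -/
theorem groundVector_spinOne_of_gaps {F : Model k} (hF : F.IsSymmetric) {n : ℕ} {hi lo₁ lo₂ : ℚ}
    (hU : UpperRow F (n + 1) (n - 1) hi) (hS : SingletLowerRow F n lo₁)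
    (hQ : LowerRow F (n + 2) (n - 2) lo₂) (h₁ : hi < lo₁) (h₂ : hi < lo₂) (hn : 2 ≤ n)
    {χ : Fock (Orb (Fin k))} (hχ : IsInSector n n χ) (hχ0 : χ ≠ 0)
    (hHχ : F.hamiltonian *ᵥ χ = ((F.energy n n : ℝ) : ℂ) • χ) :
    spinPlus *ᵥ χ ≠ 0 ∧ spinPlus *ᵥ (spinPlus *ᵥ χ) = 0 := by
  have hH := F.hamiltonian_isHermitian hF
  have h := UpperRow.spinOne_of_gaps hF hU hS hQ h₁ h₂ hn
  constructor
  · -- a singlet ground vector would put `E₀(2n, S = 0)` at `E(n, n)`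
    intro h0
    have hmem : χ ∈ singletSector k n := by
      rw [mem_singletSector_iff]
      exact ⟨(mem_szSector_iff_isInSector n n χ).2 hχ, h0⟩
    have hpos : 0 < (star χ ⬝ᵥ χ).re := (Complex.pos_iff.1 (dotProduct_star_self_pos_iff.2 hχ0)).1
    have hray := minEnergyOn_mul_le_re_rayleigh hH (singletSector k n) hmem
    rw [hHχ, dotProduct_smul, smul_eq_mul, Complex.re_ofReal_mul] at hray
    have hle : F.singletEnergy n ≤ F.energy n n := le_of_mul_le_mul_right hray hpos
    exact absurd h.2.1 (not_lt.2 hle)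
  · have h2 := spinPlus_pow_mulVec_eq_zero_of_gap hF (hU.balanced_of_succ_pred hF (by omega)) hQ h₂
      (by omega) hn hχ hHχ
    rwa [pow_two, ← mulVec_mulVec] at h2

/-- **Ground vectors of the `S_z = 1` sector are highest-weight vectors of weight one** (certified):
under the three legs, every eigenvector `φ` of `H_F` in the `(n+1, n−1)` sector at that sector's energy
is annihilated by `Ŝ_+` — it spans a spin-`1` multiplet (and, by `UpperRow.spinOne_of_gaps`, its energy
IS the `2n`-electron ground energy of the model). -/
theorem groundVector_szOne_highestWeight_of_gaps {F : Model k} (hF : F.IsSymmetric) {n : ℕ}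
    {hi lo₁ lo₂ : ℚ} (hU : UpperRow F (n + 1) (n - 1) hi) (hS : SingletLowerRow F n lo₁)
    (hQ : LowerRow F (n + 2) (n - 2) lo₂) (h₁ : hi < lo₁) (h₂ : hi < lo₂) (hn : 2 ≤ n)
    {φ : Fock (Orb (Fin k))} (hφ : IsInSector (n + 1) (n - 1) φ)
    (hHφ : F.hamiltonian *ᵥ φ = ((F.energy (n + 1) (n - 1) : ℝ) : ℂ) • φ) :
    spinPlus *ᵥ φ = 0 := by
  have hH := F.hamiltonian_isHermitian hF
  have hlt := UpperRow.energy_succ_pred_lt_of_gaps hF hU hS hQ h₁ h₂ hn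
  have hlt' : F.energy (n + 1) (n - 1) < sectorGroundEnergy F.hamiltonian (n + 1 + 1) (n - 1 - 1) := by
    rw [show n + 1 + 1 = n + 2 by omega, show n - 1 - 1 = n - 2 by omega]; exact hlt
  have h := spinPlus_pow_mulVec_eq_zero_of_lt hH (molecularHamiltonian_commute_spinPlus _ _ _)
    (show 1 ≤ 1 from le_rfl) (show 1 ≤ n - 1 by omega) hφ hHφ hlt'
  rwa [pow_one] at h

/-- **E₀(2n) from the `S_z = 1` sector.** Under a certified non-singlet ground state (singlet `L`
above the `(n+1, n−1)` `U`), an `(n+1, n−1)` bracket brackets the `2n`-electron ground energy of the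
model (`Bracket.bracket_pred_of_gap` + `Bracket.groundEnergy_mem`). -/
theorem Bracket.groundEnergy_mem_of_singletGap {F : Model k} (hF : F.IsSymmetric) {n : ℕ}
    {lo hi lo₁ : ℚ} (hB : Bracket F (n + 1) (n - 1) lo hi) (hS : SingletLowerRow F n lo₁)
    (h₁ : hi < lo₁) (hn : 1 ≤ n) :
    ((lo : ℚ) : ℝ) ≤ groundEnergy F.hamiltonian (2 * n) ∧
      groundEnergy F.hamiltonian (2 * n) ≤ ((hi : ℚ) : ℝ) :=
  (hB.bracket_pred_of_gap hF hS h₁ hn).groundEnergy_mem hF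

/-- **Higher spins are excluded a fortiori**: under the three legs every realised sector of the same
electron number with `|N_α − N_β| ≥ 4` lies strictly above the ground energy
(`Model.energy_le_energy_of_max_le`: sector energies are monotone in `|N_α − N_β|`). -/
theorem UpperRow.energy_lt_energy_of_gaps {F : Model k} (hF : F.IsSymmetric) {n : ℕ}
    {hi lo₁ lo₂ : ℚ} (hU : UpperRow F (n + 1) (n - 1) hi) (hS : SingletLowerRow F n lo₁)
    (hQ : LowerRow F (n + 2) (n - 2) lo₂) (h₁ : hi < lo₁) (h₂ : hi < lo₂) (hn : 2 ≤ n)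
    {a b : ℕ} (ha : a ≤ k) (hb : b ≤ k) (hsum : a + b = n + n) (hfar : n + 2 ≤ max a b) :
    F.energy n n < F.energy a b := by
  have h := UpperRow.spinOne_of_gaps hF hU hS hQ h₁ h₂ hn
  refine lt_of_lt_of_le h.2.2 ?_
  exact Model.energy_le_energy_of_max_le hF ha hb (by omega) (by
    rw [max_eq_left (by omega : n - 2 ≤ n + 2)]; exact hfar)

end Summit.Ventures.CertifiedQuantumChemistry

end
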